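import Summits.MatrixMultiplication.OmegaCensus.STPPCell22Checker
import Summits.MatrixMultiplication.OmegaCensus.STPPVosperSlackTwoCheckersSound
import Summits.MatrixMultiplication.OmegaCensus.STPPVosperSlackOneA2CoverRows

/-!
# ω-census (abelian STPP census): cell-(2,2) certificate soundness, part 2 — meaning of the shape primitives (tool file)

HONEST FRAMING (pub-omega census; verbatim): lottery ticket; floor = certified bounds/negative ranges.
Census STRUCTURE (seat pub-omega-stpp-1 gen 33, 2026-08-29), family (b2).  Mask-level meaning lemmas for the primitives of `STPPCell22Checker.lean`
(plan: HOME `pub-omega-stpp-1-g33/FIFTH-LEAF.md` §SOUNDNESS, steps S4/S6/S8): rotation algebra (`rot_zero'`, `rot_rot`), membership in `dilMask` and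
`xMask`, `nrmMask` is a rotation and `offMask` undoes it (`rot_nrmMask_offMask`), and the list facts behind `lookup22` and the link row.
UNCONDITIONAL; no `decide`.  Nothing here is progress on `ω`.

References: H. S. Warren, Hacker's Delight (2002), §2-1 (bit sets); H. Cohn, R. Kleinberg, B. Szegedy, C. Umans, FOCS 2005, Def. 5.1 (the use).
-/

namespace Summit.MatrixMultiplication.OmegaCensus.CubeNB.S2

open Summit.MatrixMultiplication.OmegaCensus.CubeNB.Bits

/-! ## §1 Rotation algebra -/

/-- Two masks below `2^p` with the same bits below `p` are equal. [folklore] -/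
theorem eq_of_tb_eq {p m n : ℕ} (hm : m < 2 ^ p) (hn : n < 2 ^ p) (h : ∀ i < p, tb m i = tb n i) : m = n :=
  Nat.eq_of_testBit_eq fun i => by
    rw [← tb_eq_testBit, ← tb_eq_testBit]
    rcases Nat.lt_or_ge i p with hi | hi
    · exact h i hi
    · rw [tb_eq_false_of_lt hm hi, tb_eq_false_of_lt hn hi]

/-- Rotation by `0` is the identity (below `2^p`). [folklore] -/
theorem rot_zero' {p m : ℕ} (hm : m < 2 ^ p) : rot p m 0 = m :=
  eq_of_tb_eq (rot_lt_two_pow p m 0) hm fun i hi => by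
    rw [tb_rot hm (Nat.zero_le p) hi, Nat.sub_zero, Nat.add_mod_right, Nat.mod_eq_of_lt hi]

/-- Rotation by `p` is the identity (below `2^p`). [folklore] -/
theorem rot_self' {p m : ℕ} (hm : m < 2 ^ p) : rot p m p = m :=
  eq_of_tb_eq (rot_lt_two_pow p m p) hm fun i hi => by
    rw [tb_rot hm le_rfl hi, Nat.add_sub_cancel, Nat.mod_eq_of_lt hi]

/-- **Rotations compose additively** (modulo `p`). [folklore] -/
theorem rot_rot {p m a b : ℕ} (hm : m < 2 ^ p) (ha : a ≤ p) (hb : b ≤ p) : rot p (rot p m a) b = rot p m ((a + b) % p) := by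
  rcases Nat.eq_zero_or_pos p with rfl | hp
  · exact eq_of_tb_eq (rot_lt_two_pow _ _ _) (rot_lt_two_pow _ _ _) fun i hi => absurd hi (Nat.not_lt_zero _)
  · refine eq_of_tb_eq (rot_lt_two_pow _ _ _) (rot_lt_two_pow _ _ _) fun i hi => ?_
    rw [tb_rot (rot_lt_two_pow p m a) hb hi, tb_rot hm ha (Nat.mod_lt _ hp), tb_rot hm (Nat.mod_lt _ hp).le hi]
    congr 1
    have h1 : b ≤ i + p := by omega
    have h2 : a ≤ (i + p - b) % p + p := by omega
    have h3 : (a + b) % p ≤ i + p := by have := Nat.mod_lt (a + b) hp; omega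
    -- the two indices agree in `ZMod p` (cf. the tree's `YM2.natCast_zmod_injOn`), hence are equal
    have key : (((i + p - b) % p + p - a) % p) % p = ((i + p - (a + b) % p) % p) % p := by
      refine (ZMod.natCast_eq_natCast_iff' _ _ p).1 ?_
      rw [ZMod.natCast_mod, ZMod.natCast_mod, Nat.cast_sub h2, Nat.cast_add, ZMod.natCast_mod, Nat.cast_sub h1, Nat.cast_sub h3,
        ZMod.natCast_mod]
      push_cast
      rw [ZMod.natCast_self]
      ring
    rwa [Nat.mod_eq_of_lt (Nat.mod_lt _ hp), Nat.mod_eq_of_lt (Nat.mod_lt _ hp)] at key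

/-! ## §2 Membership in `dilMask` and `xMask` -/

/-- **Meaning of `dilMask`**: `v ∈ dilMask p m u` iff `v = x·u mod p` for a member `x < p` of `m`. [folklore] -/
theorem tb_dilMask {p m u v : ℕ} : tb (dilMask p m u) v = true ↔ ∃ x, x < p ∧ tb m x = true ∧ x * u % p = v := by
  rw [dilMask, tb_maskOf, List.mem_map]
  constructor
  · rintro ⟨x, hx, rfl⟩
    obtain ⟨hxr, hxt⟩ := mem_members.1 hx
    exact ⟨x, List.mem_range.1 hxr, hxt, rfl⟩
  · rintro ⟨x, hxp, hxt, rfl⟩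
    exact ⟨x, mem_members.2 ⟨List.mem_range.2 hxp, hxt⟩, rfl⟩

/-- `dilMask` is a mask below `2^p` (for `0 < p`). [folklore] -/
theorem dilMask_lt_two_pow {p m u : ℕ} (hp : 0 < p) : dilMask p m u < 2 ^ p :=
  maskOf_lt_two_pow fun x hx => by
    obtain ⟨y, _, rfl⟩ := List.mem_map.1 hx
    exact Nat.mod_lt _ hp

/-- **Meaning of `xMask`**: `v ∈ xMask p y w y′` iff `v = (a + w·b) mod p` with `a ∈ {0,1,y}`, `b ∈ {0,1,y′}`. [folklore] -/
theorem tb_xMask {p y w y' v : ℕ} : tb (xMask p y w y') v = true ↔ ∃ a ∈ [0, 1, y], ∃ b ∈ [0, 1, y'], (a + w * b) % p = v := by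
  rw [xMask, tb_maskOf, List.mem_flatMap]
  constructor
  · rintro ⟨a, ha, hv⟩
    obtain ⟨b, hb, rfl⟩ := List.mem_map.1 hv
    exact ⟨a, ha, b, hb, rfl⟩
  · rintro ⟨a, ha, b, hb, rfl⟩
    exact ⟨a, ha, List.mem_map.2 ⟨b, hb, rfl⟩⟩

/-- `xMask` is a mask below `2^p` (for `0 < p`). [folklore] -/
theorem xMask_lt_two_pow {p y w y' : ℕ} (hp : 0 < p) : xMask p y w y' < 2 ^ p :=
  maskOf_lt_two_pow fun x hx => by
    obtain ⟨a, _, hx⟩ := List.mem_flatMap.1 hx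
    obtain ⟨b, _, rfl⟩ := List.mem_map.1 hx
    exact Nat.mod_lt _ hp

/-! ## §3 `nrmMask` is a rotation, `offMask` undoes it -/

/-- `nrmMask p m` is `m` or one of its rotations `rot p m t`, `t < p`. [folklore] -/
theorem nrmMask_eq_rot (p m : ℕ) : ∃ t, t < p ∧ nrmMask p m = rot p m t ∨ nrmMask p m = m := by
  have h : nrmMask p m = ((List.range p).map (rot p m)).foldl min m := by
    rw [nrmMask, List.foldl_map]
  rcases CubeNB.foldl_min_mem ((List.range p).map (rot p m)) m with h1 | h1
  · exact ⟨0, by rw [h]; exact Or.inr h1⟩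
  · rw [← h] at h1
    obtain ⟨t, ht, hteq⟩ := List.mem_map.1 h1
    exact ⟨t, Or.inl ⟨List.mem_range.1 ht, hteq.symm⟩⟩

/-- `nrmMask` is a mask below `2^p`. [folklore] -/
theorem nrmMask_lt_two_pow {p m : ℕ} (hm : m < 2 ^ p) : nrmMask p m < 2 ^ p := by
  obtain ⟨t, ht⟩ := nrmMask_eq_rot p m
  rcases ht with ⟨_, h⟩ | h
  · rw [h]; exact rot_lt_two_pow _ _ _
  · rw [h]; exact hm

/-- The original mask is a rotation of its canonical form: `m = rot p (nrmMask p m) t` for some `t ≤ p`. [folklore] -/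
theorem exists_rot_nrmMask_eq {p m : ℕ} (hm : m < 2 ^ p) : ∃ t, t ≤ p ∧ rot p (nrmMask p m) t = m := by
  obtain ⟨t, ht⟩ := nrmMask_eq_rot p m
  rcases ht with ⟨htp, h⟩ | h
  · refine ⟨p - t, Nat.sub_le _ _, ?_⟩
    rw [h, rot_rot hm htp.le (Nat.sub_le _ _), show t + (p - t) = p by omega, Nat.mod_self, rot_zero' hm]
  · exact ⟨0, Nat.zero_le _, by rw [h, rot_zero' hm]⟩

/-- **`offMask` undoes `nrmMask`**: `rot p σ (offMask p σ S) = S` for `σ = nrmMask p S`. [folklore] -/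
theorem rot_nrmMask_offMask {p S : ℕ} (hS : S < 2 ^ p) : rot p (nrmMask p S) (offMask p (nrmMask p S) S) = S := by
  rcases Nat.eq_zero_or_pos p with rfl | hp
  · have hS0 : S = 0 := by simpa using hS
    subst hS0; decide
  set σ := nrmMask p S with hσ
  obtain ⟨t, htp, ht⟩ := exists_rot_nrmMask_eq hS
  rw [← hσ] at ht
  -- `find?` succeeds: `t` (or `0` if `t = p`) is a witness in `List.range p`
  have hw : ∃ t' ∈ List.range p, Nat.beq (rot p σ t') S = true := by
    rcases Nat.lt_or_ge t p with h | h
    · exact ⟨t, List.mem_range.2 h, by rw [ht]; simp⟩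
    · have htp' : t = p := le_antisymm htp h
      refine ⟨0, List.mem_range.2 hp, ?_⟩
      rw [htp'] at ht
      rw [rot_zero' (nrmMask_lt_two_pow hS), ← rot_self' (nrmMask_lt_two_pow hS), ht]; simp
  unfold offMask
  cases hf : (List.range p).find? (fun t' => Nat.beq (rot p σ t') S) with
  | none =>
    obtain ⟨t', ht', hbeq⟩ := hw
    have := (List.find?_eq_none.1 hf) t' ht'
    exact absurd hbeq (by simpa using this)
  | some a =>
    have h1 := List.find?_some hf
    simp only [Option.getD_some]
    exact Nat.eq_of_beq_eq_true (by simpa using h1)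

/-! ## §4 The list facts behind `lookup22` and the link row -/

/-- `lookup22` finds a listed group containing the pair. [folklore] -/
theorem exists_of_lookup22 {tbl : List (ℕ × List ℕ)} {mY mZ : ℕ} (h : lookup22 tbl mY mZ = true) : ∃ g ∈ tbl, g.1 = mY ∧ mZ ∈ g.2 := by
  rw [lookup22, List.any_eq_true] at h
  obtain ⟨g, hg, hb⟩ := h
  rw [Bool.and_eq_true, List.any_eq_true] at hb
  obtain ⟨h1, z, hz, h2⟩ := hb
  refine ⟨g, hg, Nat.eq_of_beq_eq_true h1, ?_⟩
  rw [← Nat.eq_of_beq_eq_true h2]; exact hz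

/-- The link row as membership: a grouped pair found by `Nat.beq` scanning is a member of the flat table. [folklore] -/
theorem mem_of_any_beq_pair {flat : List (ℕ × ℕ)} {a b : ℕ} (h : (flat.any fun e => Nat.beq e.1 a && Nat.beq e.2 b) = true) : (a, b) ∈ flat := by
  rw [List.any_eq_true] at h
  obtain ⟨e, he, hb⟩ := h
  rw [Bool.and_eq_true] at hb
  have h1 := Nat.eq_of_beq_eq_true hb.1
  have h2 := Nat.eq_of_beq_eq_true hb.2
  obtain ⟨e1, e2⟩ := e
  simp only at h1 h2
  subst h1; subst h2; exact he

end Summit.MatrixMultiplication.OmegaCensus.CubeNB.S2
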